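import Literature.Barriers.QuantumFields.GoldstoneTheoremLemmaI
import Literature.Barriers.QuantumFields.GoldstoneTheoremSpectral
import Literature.MathematicalPhysics.QuantumLattice.SchwartzPartition
import HarnessLib

/-!
# Goldstone's theorem (Kastler–Robinson–Swieca): proof of Lemma IV

Discharge of the named fact `Literature.Barriers.QuantumFields.KRSLemmaIV` (barrier catalogue
`Literature/Barriers/QuantumFields/`, file `GoldstoneTheorem`): **Lemma IV** of
Kastler–Robinson–Swieca (Commun. Math. Phys. 2 (1966), p. 116, (47)) for strictly local `A` —
under assumptions 1.–5. with smallest mass `m > 0`, for `A ∈ 𝔄(𝒪_L)`, `d > 0` and every family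
`f_R ⊗ f_d ∈ 𝒟_R ⊗ 𝒟_d`, `lim_{R → ∞} (Ω, [j⁰(f_R f_d), A] Ω) = 0` (`KRSLemmaIV_holds`). In fact
the commutator vanishes identically for `R > L + d` (`commVEV_eq_zero_of_lt`).

## The proof

KRS prove Lemma IV from Lemma I (independence of the choices, §III p. 112), Lemma II (a decay
estimate from clustering) and Lemma III (`(A - ⟨A⟩) Ω = (P⁰)ᵏ A' Ω`, which uses the gap). We
follow the same mechanism — current conservation makes the charge commutator insensitive to
translations of the test function, the energy gap makes positive-energy matrix coefficients
average to zero against probes with spectral support below `m` — but organise it without Lemmas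
II-III:

1. (`GoldstoneTheoremLemmaI`) By Lemma I, for `R > L + d` the commutator `q = (Ω, [j⁰(f_R f_d), A] Ω)`
   does not depend on `f_R ∈ 𝒟_R`, on `f_d`, nor on `R`; and for the translated test function
   `(f_R f_d)_a`, `|a⁰| + |a⃗| < R - L - d`, it is still `q`.
2. (this file, `exists_latticeChargeFamily`) Replace `f_R` by the lattice cut-offs
   `W_n ⊗ f_d = Σ_{β ∈ [-n,n]³ ∩ ℤ³} (η₀ ⊗ f_d)(· - (0, β))` of the tree's smooth partition of
   unity (`Literature.MathematicalPhysics.QuantumLattice.latticeWindow`, `= 1` on `|x⃗| ≤ n/2`): by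
   translation covariance 5(b) and unitarity the current vectors `χ_n = j⁰(W_n f_d) Ω`,
   `χ'_n = j⁰((W_n f_d)‾) Ω` have norm `≤ (2n+1)³ · const` (`norm_cur_sum_compSubConstCLM_le`).
3. (`GoldstoneTheoremSpectral`) With `E_n(a) = ⟪T(a) χ'_n, A Ω⟫ - ⟪A* Ω, T(a) χ_n⟫` — equal to the
   commutator of the translated test function by 5(b), hence `= q` on the ball
   `|a| < S_n = (n/2 - L - d)/2` by step 1, and bounded by `B_n = O(n³)` — and the even probe
   `Φ = 𝓕 g`, `supp g ⊆ {|p| < m/2π}`, `∫ Φ = 1`: the gap gives `∫ Φ E_n = 0`, whence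
   `|q| ≤ 2 B_n S_n⁻⁴ ∫ |a|⁴ |Φ| = O(1/n)`, so `q = 0`.

## References

[KastlerRobinsonSwieca1966] §II (assumptions), §III Lemma I, Lemma IV (47).
-/

noncomputable section

open Filter Topology ComplexConjugate MeasureTheory Set
open scoped InnerProductSpace SchwartzMap FourierTransform RealInnerProductSpace ContDiff

namespace Literature.Barriers.QuantumFields

open Literature.MathematicalPhysics.QuantumLattice Literature.Analysis.UnboundedOperators
open LocalNetWithCurrent

/-! ### The lattice family of charge test functions -/

/-- The window `w_R` of the tree's partition of unity vanishes for `|t| ≥ R + 1` (`R ≥ 0`).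
[folklore] -/
theorem pouWindow_eq_zero {R t : ℝ} (hR : 0 ≤ R) (ht : R + 1 ≤ |t|) : pouWindow R t = 0 := by
  rcases le_abs'.mp ht with h | h
  · rw [pouWindow, Real.smoothTransition.zero_of_nonpos (by linarith),
      Real.smoothTransition.zero_of_nonpos (by linarith), sub_zero]
  · rw [pouWindow, Real.smoothTransition.one_of_one_le (by linarith),
      Real.smoothTransition.one_of_one_le (by linarith), sub_self]

/-- The discrete cube `[-n, n]³ ∩ ℤ³` has `(2n+1)³` points. [folklore] -/
theorem card_latticeCube_three (n : ℕ) : (latticeCube 3 n).card = (2 * n + 1) ^ 3 := by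
  rw [latticeCube, Fintype.card_piFinset, Finset.prod_const, Finset.card_univ, Fintype.card_fin,
    Int.card_Icc]
  congr 1
  omega

/-- **The lattice family of charge test functions.** Given a time smearing `f_d ∈ 𝒟_d` there
are a Schwartz function `Θ = η₀ ⊗ f_d` (`η₀` the basic bump of the tree's lattice partition of
unity on `ℝ³`) and, for every `n`, the finite sum of its spatial lattice translates
`Ψ_n = Σ_{β ∈ [-n,n]³ ∩ ℤ³} Θ(· - (0, β))`, which is of product form `W_n ⊗ f_d` with
`W_n = Σ_β η_β` the lattice window — smooth, compactly supported and `= 1` on `|x⃗| < n/2` — so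
`Ψ_n ∈ 𝒟_{n/2} ⊗ 𝒟_d`. [folklore] -/
theorem exists_latticeChargeFamily {δ : ℝ} {fd : ℝ → ℂ} (hfd : IsTimeSmearing δ fd) :
    ∃ (Θ : 𝓢(SpaceTime 3, ℂ)) (Ψ : ℕ → 𝓢(SpaceTime 3, ℂ)),
      (∀ n, Ψ n = ∑ β ∈ latticeCube 3 n,
        SchwartzMap.compSubConstCLM ℂ (ofTimeSpace 0 (intVec β) : SpaceTime 3) Θ) ∧
      ∀ n : ℕ, ∃ g : EuclideanSpace ℝ (Fin 3) → ℂ, IsSpaceCutoff ((n : ℝ) / 2) g ∧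
        ∀ x, Ψ n x = g (spaceC 3 x) * fd (x 0) := by
  obtain ⟨hfd_smooth, hfd_supp, -⟩ := hfd
  have hfdc : HasCompactSupport fd :=
    HasCompactSupport.of_support_subset_isCompact isCompact_Icc
      ((subset_tsupport _).trans hfd_supp)
  set Λ : EuclideanSpace ℝ (Fin 3) ≃L[ℝ] EuclideanSpace ℝ (Fin 3) := ContinuousLinearEquiv.refl ℝ _
    with hΛ
  -- the basic bump `η₀ ⊗ f_d`
  set η : EuclideanSpace ℝ (Fin 3) → ℂ := fun y => ((latticeBump Λ 0 y : ℝ) : ℂ) with hη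
  have hη_smooth : ContDiff ℝ ∞ η := contDiff_ofReal_comp ℂ (contDiff_latticeBump Λ 0)
  have hη_cpt : HasCompactSupport η :=
    (hasCompactSupport_latticeBump Λ 0).comp_left (g := fun r : ℝ => (r : ℂ)) rfl
  obtain ⟨Θ, hΘ⟩ := exists_schwartz_tensor hη_smooth hη_cpt hfd_smooth hfdc
  refine ⟨Θ, fun n => ∑ β ∈ latticeCube 3 n,
    SchwartzMap.compSubConstCLM ℂ (ofTimeSpace 0 (intVec β) : SpaceTime 3) Θ, fun n => rfl,
    fun n => ⟨fun y => ((latticeWindow Λ n y : ℝ) : ℂ), ⟨?_, ?_, ?_⟩, fun x => ?_⟩⟩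
  · exact contDiff_ofReal_comp ℂ (contDiff_latticeWindow Λ n)
  · -- compact support: the window vanishes outside the cube of side `n + 1`
    refine HasCompactSupport.of_support_subset_isCompact
      (isCompact_closedBall (0 : EuclideanSpace ℝ (Fin 3)) (√3 * (n + 1))) ?_
    intro y hy
    rw [Function.mem_support] at hy
    rw [Metric.mem_closedBall, dist_zero_right]
    have hcoord : ∀ c, |y c| ≤ n + 1 := by
      intro c
      by_contra h
      apply hy
      have : latticeWindow Λ n y = 0 := by
        apply Finset.prod_eq_zero (Finset.mem_univ c)
        exact pouWindow_eq_zero n.cast_nonneg (by simpa [hΛ] using (lt_of_not_ge h).le)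
      simp [this]
    simpa using EuclideanSpace.norm_le_sqrt_card_mul y (by positivity) hcoord
  · intro y hy
    have h1 : ‖(Λ : EuclideanSpace ℝ (Fin 3) →L[ℝ] EuclideanSpace ℝ (Fin 3))‖ ≤ 1 := by
      rw [hΛ, ContinuousLinearEquiv.coe_refl]
      exact ContinuousLinearMap.norm_id_le
    have h2 : ‖y‖ ≤ n / (‖(Λ : EuclideanSpace ℝ (Fin 3) →L[ℝ] EuclideanSpace ℝ (Fin 3))‖ + 1) := by
      have h0 := norm_nonneg (Λ : EuclideanSpace ℝ (Fin 3) →L[ℝ] EuclideanSpace ℝ (Fin 3))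
      rw [le_div_iff₀ (by linarith)]
      nlinarith [norm_nonneg y]
    simp [latticeWindow_eq_one Λ h2]
  · simp only [sum_apply, SchwartzMap.compSubConstCLM_apply, hΘ, map_sub,
      spaceC_ofTimeSpace, PiLp.sub_apply, ofTimeSpace_apply_zero, sub_zero, hη]
    rw [← Finset.sum_mul, ← sum_latticeCube_latticeBump, Complex.ofReal_sum]
    congr 1
    refine Finset.sum_congr rfl fun β _ => ?_
    rw [latticeBump_eq_comp_sub Λ β]
    simp [hΛ]

variable {N : LocalNetWithCurrent}

/-- **Norm of the current vector of a sum of translates**: by translation covariance 5(b) and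
unitarity of `T`, `‖j^μ(Σᵢ Θ(· - vᵢ)) Ω‖ ≤ #{i} · ‖j^μ(Θ) Ω‖`.
[cite: KastlerRobinsonSwieca1966, §II 5(b)] -/
theorem norm_cur_sum_compSubConstCLM_le {m : ℝ} (hN : N.IsKRS m) (μ : Fin 4)
    (Θ : 𝓢(SpaceTime 3, ℂ)) {ι : Type*} (s : Finset ι) (v : ι → SpaceTime 3) :
    ‖N.cur μ (∑ i ∈ s, SchwartzMap.compSubConstCLM ℂ (v i) Θ)‖ ≤ s.card * ‖N.cur μ Θ‖ := by
  rw [map_sum]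
  refine (norm_sum_le _ _).trans ?_
  have h : ∀ i ∈ s, ‖N.cur μ (SchwartzMap.compSubConstCLM ℂ (v i) Θ)‖ = ‖N.cur μ Θ‖ := by
    intro i _
    rw [← hN.cur_covariant, UnitaryRep.norm_map]
  rw [Finset.sum_congr rfl h, Finset.sum_const, nsmul_eq_mul]

/-- Conjugation commutes with sums of translates of test functions. [folklore] -/
theorem starTest_sum_compSubConstCLM (Θ : 𝓢(SpaceTime 3, ℂ)) {ι : Type*} (s : Finset ι)
    (v : ι → SpaceTime 3) :
    starTest (∑ i ∈ s, SchwartzMap.compSubConstCLM ℂ (v i) Θ) =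
      ∑ i ∈ s, SchwartzMap.compSubConstCLM ℂ (v i) (starTest Θ) := by
  rw [map_sum]
  refine Finset.sum_congr rfl fun i _ => ?_
  ext x
  simp [SchwartzMap.compSubConstCLM_apply]

/-- `|a⃗| ≤ |a|` for `a ∈ ℝ^{1+3}` (Euclidean norms). [folklore] -/
theorem norm_spaceC_le (a : SpaceTime 3) : ‖spaceC 3 a‖ ≤ ‖a‖ := by
  rw [EuclideanSpace.norm_eq, EuclideanSpace.norm_eq]
  apply Real.sqrt_le_sqrt
  conv_rhs => rw [Fin.sum_univ_succ]
  simp only [spaceC_apply]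
  linarith [sq_nonneg ‖a 0‖]

/-- `|a⁰| ≤ |a|` for `a ∈ ℝ^{1+3}`. [folklore] -/
theorem abs_apply_zero_le_norm (a : SpaceTime 3) : |a 0| ≤ ‖a‖ := by
  simpa using PiLp.norm_apply_le a 0

/-- **The charge commutator of a translated test function in covariance form**:
`(Ω, [j^μ(f_a), A] Ω) = ⟪T(a) j^μ(f̄) Ω, A Ω⟫ - ⟪A* Ω, T(a) j^μ(f) Ω⟫` by 5(b).
[cite: KastlerRobinsonSwieca1966, §II 5(b), (6)] -/
theorem commVEV_compSubConstCLM {m : ℝ} (hN : N.IsKRS m) (μ : Fin 4) (a : SpaceTime 3)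
    (f : 𝓢(SpaceTime 3, ℂ)) (A : N.H →L[ℂ] N.H) :
    N.commVEV μ (SchwartzMap.compSubConstCLM ℂ a f) A =
      ⟪N.T (Multiplicative.ofAdd a) (N.cur μ (starTest f)), A N.Ω⟫_ℂ -
        ⟪(star A) N.Ω, N.T (Multiplicative.ofAdd a) (N.cur μ f)⟫_ℂ := by
  have h : starTest (SchwartzMap.compSubConstCLM ℂ a f) =
      SchwartzMap.compSubConstCLM ℂ a (starTest f) := by
    ext x
    simp [SchwartzMap.compSubConstCLM_apply]
  rw [commVEV, h, ← hN.cur_covariant, ← hN.cur_covariant]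

/-! ### Lemma IV -/

/-- **The charge commutator of a strictly local operator vanishes identically for large cut-off
radius.** Under `IsKRS m` (`m > 0`), for `A ∈ 𝔄(𝒪_L)`, a charge test family `F = (f_R ⊗ f_d)_R`
of width `d` and every `R > L + d`: `(Ω, [j⁰(f_R f_d), A] Ω) = 0`. (KRS state the limit
`R → ∞`; by Lemma I the commutator is constant in `R > L + d`, and the constant is shown to be
`0` by the probe argument described in the module docstring.)
[cite: KastlerRobinsonSwieca1966, §III Lemma IV (47), Lemma I] -/
theorem commVEV_eq_zero_of_lt {m : ℝ} (hN : N.IsKRS m) {L : ℝ}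
    {A : N.H →L[ℂ] N.H} (hA : A ∈ N.alg (krsDiamond L)) {δ : ℝ}
    {F : ℝ → 𝓢(SpaceTime 3, ℂ)} (hF : IsChargeTestFamily δ F) {R : ℝ} (hR : L + δ < R) :
    N.commVEV 0 (F R) A = 0 := by
  obtain ⟨fd, hfd, hF⟩ := hF
  obtain ⟨gR, hgR, hFR⟩ := hF R
  -- the lattice family and the spectral probe
  obtain ⟨Θ, Ψ, hΨsum, hΨcut⟩ := exists_latticeChargeFamily hfd
  obtain ⟨g, hg_supp, hg_even, hg0⟩ := exists_spectralProbe hN.mass_pos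
  have hg_supp' := hg_supp.trans (ball_subset_compl_preimage_forwardMassShellRegion m)
  have hΦeven := fourier_neg_of_even hg_even
  have hΦone : ∫ a, (𝓕 g : 𝓢(SpaceTime 3, ℂ)) a = 1 := by rw [integral_fourier_eq, hg0]
  set M : ℝ := ∫ a : SpaceTime 3, ‖a‖ ^ 4 * ‖(𝓕 g : 𝓢(SpaceTime 3, ℂ)) a‖ with hM
  have hM0 : 0 ≤ M := integral_nonneg fun a => by positivity
  set K : ℝ := ‖N.cur 0 (starTest Θ)‖ * ‖A N.Ω‖ + ‖(star A) N.Ω‖ * ‖N.cur 0 Θ‖ with hK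
  have hK0 : 0 ≤ K := by positivity
  -- Step 1 (Lemma I): the commutator equals that of every lattice test function `Ψ n`, `n` large
  have hstep1 : ∀ n : ℕ, L + δ < n / 2 → N.commVEV 0 (F R) A = N.commVEV 0 (Ψ n) A := by
    intro n hn
    obtain ⟨gn, hgn, hΨn⟩ := hΨcut n
    exact commVEV_eq_of_spaceCutoff hN hA hfd.2.1 hgR hgn hFR hΨn hR hn 0
  -- Step 2 (spectral): the lattice commutators are small
  have hstep2 : ∀ n : ℕ, L + δ < n / 2 → ‖N.commVEV 0 (Ψ n) A‖ ≤
      2 * ((2 * n + 1) ^ 3 * K) * ((((n : ℝ) / 2 - L - δ) / 2) ^ 4)⁻¹ * M := by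
    intro n hn
    obtain ⟨gn, hgn, hΨn⟩ := hΨcut n
    set q : ℂ := N.commVEV 0 (Ψ n) A with hq
    set χ : N.H := N.cur 0 (Ψ n) with hχ
    set χ' : N.H := N.cur 0 (starTest (Ψ n)) with hχ'
    set E : SpaceTime 3 → ℂ := fun a =>
      ⟪N.T (Multiplicative.ofAdd a) χ', A N.Ω⟫_ℂ -
        ⟪(star A) N.Ω, N.T (Multiplicative.ofAdd a) χ⟫_ℂ with hE
    have hE_cont : Continuous E :=
      (continuous_inner_T_left χ' (A N.Ω)).sub (continuous_inner_T_right ((star A) N.Ω) χ)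
    -- norms of the current vectors grow like `(2n+1)³`
    have hχn : ‖χ‖ ≤ (2 * n + 1) ^ 3 * ‖N.cur 0 Θ‖ := by
      have h := norm_cur_sum_compSubConstCLM_le hN 0 Θ (latticeCube 3 n)
        (fun β => (ofTimeSpace 0 (intVec β) : SpaceTime 3))
      rw [← hΨsum n, card_latticeCube_three] at h
      exact_mod_cast h
    have hχ'n : ‖χ'‖ ≤ (2 * n + 1) ^ 3 * ‖N.cur 0 (starTest Θ)‖ := by
      have h := norm_cur_sum_compSubConstCLM_le hN 0 (starTest Θ) (latticeCube 3 n)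
        (fun β => (ofTimeSpace 0 (intVec β) : SpaceTime 3))
      rw [← starTest_sum_compSubConstCLM, ← hΨsum n, card_latticeCube_three] at h
      exact_mod_cast h
    have hE_bd : ∀ a, ‖E a‖ ≤ (2 * n + 1) ^ 3 * K := by
      intro a
      calc ‖E a‖ ≤ ‖⟪N.T (Multiplicative.ofAdd a) χ', A N.Ω⟫_ℂ‖ +
            ‖⟪(star A) N.Ω, N.T (Multiplicative.ofAdd a) χ⟫_ℂ‖ := norm_sub_le _ _
        _ ≤ ‖χ'‖ * ‖A N.Ω‖ + ‖(star A) N.Ω‖ * ‖χ‖ :=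
            add_le_add (norm_inner_T_left_le _ _ _) (norm_inner_T_right_le _ _ _)
        _ ≤ (2 * n + 1) ^ 3 * ‖N.cur 0 (starTest Θ)‖ * ‖A N.Ω‖ +
            ‖(star A) N.Ω‖ * ((2 * n + 1) ^ 3 * ‖N.cur 0 Θ‖) := by gcongr
        _ = (2 * n + 1) ^ 3 * K := by rw [hK]; ring
    -- by covariance and Lemma I, `E = q` on the ball of radius `S`
    have hS : 0 < ((n : ℝ) / 2 - L - δ) / 2 := by linarith
    have hE_eq : ∀ a, ‖a‖ < ((n : ℝ) / 2 - L - δ) / 2 → E a = q := by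
      intro a ha
      have h1 := norm_spaceC_le a
      have h2 := abs_apply_zero_le_norm a
      simp only [hE, hχ, hχ', ← commVEV_compSubConstCLM hN]
      exact commVEV_compSubConstCLM_eq hN hA hfd hgn hΨn a (by linarith)
    -- the current vectors are orthogonal to the vacuum, 5(a)
    have hχ0 : ⟪N.Ω, χ⟫_ℂ = 0 := hN.cur_vacuum 0 _
    have hχ'0 : ⟪N.Ω, χ'⟫_ℂ = 0 := hN.cur_vacuum 0 _
    have hint : ∫ a, (𝓕 g : 𝓢(SpaceTime 3, ℂ)) a * E a = 0 :=
      integral_fourier_mul_comm_eq_zero hN hg_supp' hΦeven hχ0 hχ'0 A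
    have h := norm_mul_norm_integral_le (𝓕 g) hE_cont hS hE_bd hE_eq hint 4
    rwa [hΦone, norm_one, mul_one] at h
  -- Step 3: the bound is `O(1/n)`, so the (n-independent) commutator vanishes
  set v : ℂ := N.commVEV 0 (F R) A with hv
  set C : ℝ := 2 * (27 * K) * 8 ^ 4 * M with hC
  have hC0 : 0 ≤ C := by positivity
  have hvn : ∀ n : ℕ, 1 ≤ (n : ℝ) → 4 * (L + δ) ≤ n → ‖v‖ ≤ C / n := by
    intro n hn1 hn4
    have hn : L + δ < n / 2 := by linarith
    rw [hstep1 n hn]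
    refine (hstep2 n hn).trans ?_
    have h1 : ((n : ℝ) / 8) ^ 4 ≤ (((n : ℝ) / 2 - L - δ) / 2) ^ 4 :=
      pow_le_pow_left₀ (by positivity) (by linarith) 4
    have h2 : (2 * (n : ℝ) + 1) ^ 3 ≤ 27 * n ^ 3 := by
      have h3 : (2 * (n : ℝ) + 1) ^ 3 ≤ (3 * n) ^ 3 :=
        pow_le_pow_left₀ (by positivity) (by linarith) 3
      linarith [h3, show (3 * (n : ℝ)) ^ 3 = 27 * n ^ 3 by ring]
    have hn8 : 0 < ((n : ℝ) / 8) ^ 4 := by positivity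
    calc 2 * ((2 * (n : ℝ) + 1) ^ 3 * K) * ((((n : ℝ) / 2 - L - δ) / 2) ^ 4)⁻¹ * M
        ≤ 2 * (27 * n ^ 3 * K) * (((n : ℝ) / 8) ^ 4)⁻¹ * M := by
          gcongr
      _ = C / n := by
          rw [hC]
          field_simp
  have hv0 : ‖v‖ ≤ 0 := by
    refine le_of_forall_pos_le_add fun ε hε => ?_
    obtain ⟨n, hn⟩ := exists_nat_gt (max (max 1 (4 * (L + δ))) (C / ε))
    have hn1 : (1 : ℝ) ≤ n := ((le_max_left _ _).trans (le_max_left _ _)).trans hn.le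
    have hn4 : 4 * (L + δ) ≤ n := ((le_max_right _ _).trans (le_max_left _ _)).trans hn.le
    have hnε : C / ε < n := (le_max_right _ _).trans_lt hn
    have hnpos : (0 : ℝ) < n := by linarith
    calc ‖v‖ ≤ C / n := hvn n hn1 hn4
      _ ≤ ε := by
          rw [div_le_iff₀ hnpos]
          rw [div_lt_iff₀ hε] at hnε
          linarith
      _ = 0 + ε := (zero_add ε).symm
  exact norm_le_zero_iff.mp hv0

/-- **Kastler–Robinson–Swieca, Lemma IV, for strictly local operators** — discharge of the named
fact `KRSLemmaIV`: under assumptions 1.–5. with smallest mass `m > 0`, for every strictly local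
`A`, every `d > 0` and every family `f_R ⊗ f_d ∈ 𝒟_R ⊗ 𝒟_d`,
`lim_{R → ∞} (Ω, [j⁰(f_R f_d), A] Ω) = 0` (47) (indeed the commutator is `0` for `R > L + d`,
`commVEV_eq_zero_of_lt`). [cite: KastlerRobinsonSwieca1966, §III Lemma IV (47)] -/
theorem KRSLemmaIV_holds : KRSLemmaIV := by
  intro N m hN A hA δ _hδ F hF
  obtain ⟨L, hAL⟩ := hA
  apply tendsto_const_nhds.congr'
  filter_upwards [eventually_gt_atTop (L + δ)] with R hR
  exact (commVEV_eq_zero_of_lt hN hAL hF hR).symm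

end Literature.Barriers.QuantumFields
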